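import Summits.BirchSwinnertonDyer.BirchSwinnertonDyer.Theorems.ResidualThetaTransportAtTwoSignedMuVanishingAtTwoPlusCuspSpanGenerationTwoPrimesTools
import HarnessLib

/-!
# Node (G′)_N = `CuspSpanEvenAtTwo N` (item 27436): the ROW-2 REDUCTION — a `b = −2` element times two `b = −1` elements lands in the
# `4^k`-classes under ONE explicit arithmetic condition, so «`B₂`-vanishing» (the residue of the node at `N = p^a q^b` after
# `…CuspSpanGenerationRows`) is a divisor-in-a-progression statement

Cell `bsd-wall`, lead `bsd-wall-rtt-p4` g9 (crux Kμ⁺ stmt-BirchSwinnertonDyer-20689, stub `stub_flatMuZeroAtTwo` ⟸ node 27436). THEOREMS ONLY;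
helper `--supports` the crux; BSD is not proved by this. For the width seats' `B₂`-programme (rows of (G‴)_N):

* `b2_triple_apply_one_one` — the IDENTITY: for `β = (α, −2; c, δ)`, `β_v = (α_v, −1; c_v, v)` (so `c_v = 1 − α_v v`) and any `β_w` with
  upper-right entry `−1` and lower-right entry `w`: `(β·β_v·β_w)₁₁ = (α_v + w)·(δ v − c) − δ`. (Only `det β_v = 1` is used.)
* `chi_b2_eq_zero_of_witness` — hence, for an additive `χ` killing the `4^k`-classes (`|d| = 4^k`, `k ≥ 1`) and the `b = −1` elements: a
  `b = −2` element `β` is killed as soon as there are `b = −1` elements `β_v, β_w ∈ Γ₀(N)` and `k ≥ 1` with `|(α_v + w)(δ v − c) − δ| = 4^k`.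
* `chi_b2_eq_zero_of_dvd` — the arithmetic form (`N` odd): it suffices to find `v` with `β_v ∈ Γ₀(N)` (i.e. `α_v v + N κ_v = 1`) such that
  `M := δ v − c` divides `ε 4^k + δ` (`ε = ±1`, `k ≥ 1`); then `w := (ε4^k + δ)/M − α_v` is automatically prime to `N` (`δ v w ≡ ε 4^k`)
  and `β_w` exists. With `c = (1 − αδ)/2` one has `M = (δ(2v + α) − 1)/2`; e.g. `M = ±(ε4^k + δ)` needs `δ ∣ 2^{2k+1} ± 1` — after replacing
  `δ` by a Dirichlet prime `ℓ ≡ δ (mod 2N)`, `ℓ ≡ 3 (mod 4)` in its class (the class of a `b = −2` element is `δ mod 2N`), this holds for some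
  `k` (`ord_ℓ 2 ≢ 0 (mod 4)`), and the remaining unit condition on `v = (u − α)/2` reads `δ ≢ −ε4^k (mod every prime of N)` — the
  bookkeeping left to the `SafePrimes` toolkit (rtt-p3-w5). Nothing of that is asserted here.

References: R. S. Kulkarni, Amer. J. Math. 113 (1991) [Kulkarni1991]; R. Pollack, Duke Math. J. 118 (2003) Conj. 6.3 [Pollack2003].
-/

set_option autoImplicit false
set_option linter.dupNamespace false

open scoped MatrixGroups

open CongruenceSubgroup

namespace Summit.BirchSwinnertonDyer.BirchSwinnertonDyer.Theorems.SignedMuAtTwo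

namespace Rows

variable {N : ℕ} {χ : Gamma0 N → ZMod 2}

/-- **The row-2 identity.** For `β, β_v, β_w ∈ Γ₀(N)` with `b(β_v) = b(β_w) = −1` (nothing is assumed on `β`; used for `b(β) = −2`):
`(β β_v β_w)₁₁ = (a(β_v) + d(β_w))·(d(β)·d(β_v) − c(β)) − d(β)`. [folklore] -/
theorem b2_triple_apply_one_one (β βv βw : Gamma0 N)
    (hbv : (βv : SL(2, ℤ)) 0 1 = -1) (hbw : (βw : SL(2, ℤ)) 0 1 = -1) :
    ((β * βv * βw : Gamma0 N) : SL(2, ℤ)) 1 1 =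
      ((βv : SL(2, ℤ)) 0 0 + (βw : SL(2, ℤ)) 1 1) * ((β : SL(2, ℤ)) 1 1 * (βv : SL(2, ℤ)) 1 1 - (β : SL(2, ℤ)) 1 0) -
        (β : SL(2, ℤ)) 1 1 := by
  have hdetv : (βv : SL(2, ℤ)) 0 0 * (βv : SL(2, ℤ)) 1 1 - (βv : SL(2, ℤ)) 0 1 * (βv : SL(2, ℤ)) 1 0 = 1 := by
    have := Matrix.SpecialLinearGroup.det_coe (βv : SL(2, ℤ))
    rwa [Matrix.det_fin_two] at this
  rw [hbv] at hdetv
  have e10 : ((β * βv : Gamma0 N) : SL(2, ℤ)) 1 0 =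
      (β : SL(2, ℤ)) 1 0 * (βv : SL(2, ℤ)) 0 0 + (β : SL(2, ℤ)) 1 1 * (βv : SL(2, ℤ)) 1 0 :=
    (Matrix.two_mul_expl ((β : SL(2, ℤ)) : Matrix (Fin 2) (Fin 2) ℤ) ((βv : SL(2, ℤ)) : Matrix (Fin 2) (Fin 2) ℤ)).2.2.1
  have e11 : ((β * βv : Gamma0 N) : SL(2, ℤ)) 1 1 =
      (β : SL(2, ℤ)) 1 0 * (βv : SL(2, ℤ)) 0 1 + (β : SL(2, ℤ)) 1 1 * (βv : SL(2, ℤ)) 1 1 := gamma0_mul_apply_one_one' β βv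
  rw [gamma0_mul_apply_one_one', e10, e11, hbv, hbw]
  linear_combination (-(β : SL(2, ℤ)) 1 1) * hdetv

/-- **An element is killed by a `4^k`-witness** (used for `b(β) = −2`; nothing on `β` is assumed). If the additive `χ` kills the elements
with `|d| = 4^k` (`k ≥ 1`) and the elements with `b = −1`, and `β`, `β_v`, `β_w` (`b(β_v) = b(β_w) = −1`) satisfy `|(a(β_v) + d(β_w))(d(β)d(β_v) − c(β)) − d(β)| = 4^k` for some `k ≥ 1`, then
`χ β = 0`. [cite: Pollack2003, Conj. 6.3] -/
theorem chi_b2_eq_zero_of_witness (hadd : ∀ γ δ : Gamma0 N, χ (γ * δ) = χ γ + χ δ)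
    (hkill : ∀ γ : Gamma0 N, (∃ k : ℕ, 1 ≤ k ∧ ((γ : SL(2, ℤ)) 1 1).natAbs = 4 ^ k) → χ γ = 0)
    (hb1 : ∀ β : Gamma0 N, (β : SL(2, ℤ)) 0 1 = -1 → χ β = 0)
    (β βv βw : Gamma0 N) (hbv : (βv : SL(2, ℤ)) 0 1 = -1) (hbw : (βw : SL(2, ℤ)) 0 1 = -1)
    {k : ℕ} (hk : 1 ≤ k)
    (hw : (((βv : SL(2, ℤ)) 0 0 + (βw : SL(2, ℤ)) 1 1) * ((β : SL(2, ℤ)) 1 1 * (βv : SL(2, ℤ)) 1 1 - (β : SL(2, ℤ)) 1 0) -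
        (β : SL(2, ℤ)) 1 1).natAbs = 4 ^ k) :
    χ β = 0 := by
  have hprod : χ (β * βv * βw) = 0 := hkill _ ⟨k, hk, by rw [b2_triple_apply_one_one β βv βw hbv hbw]; exact hw⟩
  rw [hadd, hadd, hb1 βv hbv, hb1 βw hbw, add_zero, add_zero] at hprod
  exact hprod

/-- **Arithmetic form (divisor in the class).** Let `β = (α, b; c, δ) ∈ Γ₀(N)` (intended: `b = −2`) and let `α_v v + N κ_v = 1` (so that
`β_v = (α_v, −1; Nκ_v, v) ∈ Γ₀(N)`). If `M := δ v − c` divides `ε 4^k + δ` (`M · m = ε 4^k + δ`, `ε = ±1`, `k ≥ 1`), then — for every additive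
`χ` killing the `4^k`-classes and the `b = −1` elements — `χ β = 0` (`N` odd): the third element is `β_w` with `d(β_w) = w := m − α_v`,
which is automatically prime to `N` (`δ v w ≡ ε4^k (mod N)`). [cite: Pollack2003, Conj. 6.3] -/
theorem chi_b2_eq_zero_of_dvd (hN : Odd N) (hadd : ∀ γ δ : Gamma0 N, χ (γ * δ) = χ γ + χ δ)
    (hkill : ∀ γ : Gamma0 N, (∃ k : ℕ, 1 ≤ k ∧ ((γ : SL(2, ℤ)) 1 1).natAbs = 4 ^ k) → χ γ = 0)
    (hb1 : ∀ β : Gamma0 N, (β : SL(2, ℤ)) 0 1 = -1 → χ β = 0)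
    (β : Gamma0 N)
    (αv v κv : ℤ) (hv : αv * v + N * κv = 1) (m ε : ℤ) (hε : ε = 1 ∨ ε = -1) {k : ℕ} (hk : 1 ≤ k)
    (hm : ((β : SL(2, ℤ)) 1 1 * v - (β : SL(2, ℤ)) 1 0) * m = ε * 4 ^ k + (β : SL(2, ℤ)) 1 1) :
    χ β = 0 := by
  set δ := (β : SL(2, ℤ)) 1 1 with hδ
  set c := (β : SL(2, ℤ)) 1 0 with hc
  -- `β_v`
  obtain ⟨βv, hv00, hv01, hv10, hv11⟩ :=
    ThetaLayerLambdaCongruenceAtTwo.exists_gamma0_entries (N := N) αv (-1) ((N : ℤ) * κv) v (by linear_combination hv) (dvd_mul_right _ _)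
  -- `w = m - α_v` is prime to `N`: `δ v w = ε 4^k + δ - δ v α_v + c(...)`; we show `IsCoprime w N` from `δ v w ≡ ε 4^k (mod N)`
  set w : ℤ := m - αv with hwdef
  have hcN : (N : ℤ) ∣ c := by
    have h := β.2
    rw [Gamma0_mem] at h
    exact (ZMod.intCast_zmod_eq_zero_iff_dvd _ N).mp h
  have hδu : IsCoprime δ (N : ℤ) := by
    have h := (ZMod.coe_int_isUnit_iff_isCoprime δ N).mp (by rw [hδ]; exact isUnit_gamma0_apply_one_one β)
    exact h.symm
  have hε2 : ε * ε = 1 := by rcases hε with h | h <;> rw [h] <;> norm_num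
  have hw : IsCoprime w (N : ℤ) := by
    -- `(δ v - c) m = ε 4^k + δ` and `c ≡ 0`, `α_v v ≡ 1`: `δ v w = δ v m - δ v α_v ≡ ε 4^k + δ - δ = ε 4^k`
    obtain ⟨c', hc'⟩ := hcN
    have key : δ * v * w * ε = 4 ^ k + (N : ℤ) * (ε * (c' * m + δ * κv)) := by
      rw [hwdef]
      have : δ * v * m = ε * 4 ^ k + δ + c * m := by linear_combination hm
      linear_combination ε * this - (δ * ε) * hv + (4 ^ k) * hε2 + (ε * m) * hc'
    -- `N` is odd, so `4^k` is prime to `N`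
    have h2N : IsCoprime (2 : ℤ) (N : ℤ) := by
      obtain ⟨t, ht⟩ := hN
      exact ⟨-(t : ℤ), 1, by rw [ht]; push_cast; ring⟩
    have h4N : IsCoprime ((4 : ℤ) ^ k) (N : ℤ) := by
      have : (4 : ℤ) = 2 * 2 := by norm_num
      rw [this]
      exact (IsCoprime.mul_left h2N h2N).pow_left
    obtain ⟨s, t, hst⟩ := h4N
    exact ⟨s * (δ * v * ε), t - s * (ε * (c' * m + δ * κv)), by linear_combination hst + s * key⟩
  -- `β_w`
  obtain ⟨aw, cw, haw⟩ : ∃ aw cw : ℤ, aw * w + (N : ℤ) * cw = 1 := by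
    obtain ⟨a, b, hab⟩ := hw
    exact ⟨a, b, by linear_combination hab⟩
  obtain ⟨βw, hw00, hw01, hw10, hw11⟩ :=
    ThetaLayerLambdaCongruenceAtTwo.exists_gamma0_entries (N := N) aw (-1) ((N : ℤ) * cw) w (by linear_combination haw) (dvd_mul_right _ _)
  refine chi_b2_eq_zero_of_witness hadd hkill hb1 β βv βw hv01 hw01 hk ?_
  rw [hv00, hw11, hv11, ← hδ, ← hc, hwdef]
  have : (αv + (m - αv)) * (δ * v - c) - δ = ε * 4 ^ k := by linear_combination hm
  rw [this, Int.natAbs_mul, Int.natAbs_pow]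
  rcases hε with h | h <;> rw [h] <;> simp

end Rows

end Summit.BirchSwinnertonDyer.BirchSwinnertonDyer.Theorems.SignedMuAtTwo
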